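import Summits.BirchSwinnertonDyer.BirchSwinnertonDyer.Theorems.ByReductionTypeAtTwoRankOneAtTwoBigImageOddLocalOneDoorHalvesJointCrossed
import Summits.BirchSwinnertonDyer.Rank1Residual.F1Sign2.DescentSignAtTwo
import Summits.BirchSwinnertonDyer.Rank1Residual.F1Sign2.TranspositionDoorAtTwo
import Summits.BirchSwinnertonDyer.Rank1Residual.F1Sign2.MinusHalfSumParityAtTwo
import Literature.NumberTheory.EllipticCurves.ImaginaryPeriod
import HarnessLib

/-!
# Cell `bsd-f1-sign2`, AN-33: UNIT DOORS ARE A MOD-2 MODULAR SYMBOL — door-value supply at `2`, the minus half-sum proportionality mod 2, and the unit-door value laws (-an g16, MEMO-an v1.27 §2 `#### AN-33` + v1.28 addendum AN-33h, AN-33i)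

TYPER FILING (cell `bsd-f1-sign2`, seat `-ty` g11 (draft by g10); -an g16 filing ask D-an-72 «file `F1Sign2/UnitDoorParityAtTwo.lean` := `MEMO-an-data/g16/Sketch_v24.lean`
12844fd5bc644c5c §1–§4 verbatim, REF1-gated (D-an-73)», 15:04:36Z «AN-33h, AN-33i ride with D-an-72's file»; source of record = `Sketch_v28.lean` d50ca18231cd831c
(§1/§3/§4 = v24/v26/v27 §1/§3/§4 — REF1 §122/§123: 40/40 common decls SAME; v29 adds AN-33p `EggPeriodIndexLawAtTwo` + §9, REF1 D-an-79-gated, NOT here); farm rc 0, 0 sorry; BC7 7/7 CLEAN `g16/bc/Probe_v24{,b,c}.txt`): §1, §3, §4 of the sketch VERBATIM EXCEPT REF1 §122 BLOCKING RIDER r1 APPLIED (the ONE hypothesis `Odd W.tamagawaProduct →` inserted after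
`ShaTwoTrivial W →` in AN-33d/e and `(hc : Odd W.tamagawaProduct)` threaded through the two §4 plumbing lemmas — text = REF1's `REF1-data/b122/Probe122.lean`
`…OddTam` decls under the original names, elaborated there rc 0) — same namespace
`…Rank1Residual.F1Sign2.ANg16` (the lead's `hSup` is referred to BY NAME as `…F1Sign2.ANg16.DoorValueSupplyAtTwo`), same imports plus the already
landed §2 file `F1Sign2.MinusHalfSumParityAtTwo` (TURNKEY D-an-77: `minusHalfSum`, `IsMinusSymbolUnit`, AN-33b `MinusHalfSumHeckeStepModTwo`, AN-33c
`MinusHalfSumProportionalityModTwo` — both PROVED in `F1Sign2.MinusHalfSumParityAtTwoProofs`; §2 and §5 are therefore CUT from this file, nothing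
re-declared).  Decls here (14): §1 `DoorUnitValueAt`, AN-33a `DoorValueSupplyAtTwo` (= `hSup` of
`RankOneAtTwoOneDoor.missingUpperBoundAt_two_onSlice_of_doorIndexLawUpperCAtTwo_of_doorValueSupply` CHARACTER FOR CHARACTER), `doorValueSupplyAtTwo_iff`
(`Iff.rfl`), glue `missingUpperBoundAt_two_onSlice_of_doorValueSupplyAtTwo` (PROVED); §3 CONJECTURES (`@[conjecture]`, -an's own tags) AN-33d
`EggUnitDoorValueLawAtTwo`, AN-33e `TranspositionUnitDoorValueLawAtTwo`, AN-33f `EggSymbolParityLawAtTwo` (reads `minusHalfSum`, `IsMinusSymbolUnit` of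
the §2 file), AN-33g `SilentTransportUnitDoorValueLawAtTwo`, AN-33h `NonSilentClassUnitDoorValueLawAtTwo`, AN-33i `IdentityPrimeDichotomyUnitDoorValueLawAtTwo`;
§4 PROVED plumbing `doorUnitValueAt_of_eggLaw`, `doorUnitValueAt_of_transpositionLaw`.  Typer edits = this header, rider r1 (above), the REF1/REF2 sentences in the docstrings of AN-33a/d/e/h/i, the `import` of
the §2 file replacing the in-file §2 (§5–§8 proofs likewise cut: they live in `MinusHalfSumParityAtTwoProofs`, `MinusHalfSumClosedFormProofs`,
`MinusHalfSumPureCycleProofs`, `TwistedMinusSymbolSumProofs`), and the sketch's `set_option linter.dupNamespace false` dropped (unneeded).  Nothing is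
asserted beyond the proved plumbing; BSD is not proved.
Census = BC5 WITNESS: ENGINE U (-an g16 kit j310561, j310562, j310563, tag `bsd-frontier-data`; eclib minus symbols × PARI `lfun`, `ellrank`;
1 712/1 712 slice curves, 42 096 doors `|d| ≤ 1 200`, 15 656 two-engine doors; `HOME/MEMO-an-data/g16/jobU/`, `g16/SHA16SUMS.txt`): CAL-LAW
15 678/15 678; Θ: 0 forbidden-odd half-sums among 30 816, η_W well defined 611/611 and **η_W = egg 611/611**; pure-3-cycle doors unit ⟺ egg
3 678 two-engine + 7 473 symbol doors, 0 exceptions; `Δ < 0` minimal doors unit ⟺ non-norm bit 10 641 + 23 473 doors, 0 exceptions; unit ⟺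
`Sel₂(W_d) = 0` 8 564/8 564; SUPPLY (hSup on the sample) 1 696/1 702 within `|d| ≤ 1 200` (failures 33803b1, 11340b1, 31773f1, 23925r1, 36069a1,
21300i1); AN-33g 284/284; AN-33h 10 387/10 387 (5 482 non-square at a transposition prime); AN-33i dichotomy 104/104 + 24/24, class-blind 23/23 +
7/7; pre-registered P33.6 VIOLATED as stated (42/913) → refined AN-33g.
REF1 §122 (refuter-bsd-f1-sign2-ref1 g11, 2026-08-28T16:01:50Z; `REF1-AUDIT-v1.md` l.2374, evidence `REF1-data/b122/` SHA16.txt; D-an-73 ANSWERED; gate for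
this file): «T1 `DoorValueSupplyAtTwo` SURVIVES (= kernel `hSup` by `rfl`; glue identity; bookkeeping-grade); AN-33b/c/j PROVED (kernel, std axioms; tree
p645297 7/7 verbatim); AN-33d `EggUnitDoorValueLawAtTwo` and AN-33e `TranspositionUnitDoorValueLawAtTwo` KILLED AS TYPED — hidden hypothesis
`Odd W.tamagawaProduct` (BSD₂: ord₂(L(W_d,1)/Ω(W_d)) ≥ ord₂∏c(W) + t + 2s ⇒ at even Tam no door is a unit door; kit j311923: 30/30 egg-meeting
pure-3-cycle doors on 158a1/158b1/185a1/185b1/296a1/296b1/303a1/303b1/392c1/392f1 non-unit (L/Ω = 2…18, v₂ = v₂Tam(W) + v₂Ш_an), 30/30 non-norm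
transposition doors on 57a1/58a1/77a1/88a1/106b1/118a1/122a1/129a1/135a1/143a1 non-unit (L/Ω = 4…36, v₂ = t + v₂Tam(W)); controls 37a1 L/Ω = 1,1,1);
class refuted-misstated; repaired C′ = insert `Odd W.tamagawaProduct →` after `ShaTwoTrivial W →` (elaborates, Probe122) SURVIVES the census (P33.4
3 125/562/0, 608/608; P33.5 6 693/3 948/0; replay122 9aab19e60517180f of rows 766846bacd3e3f42, 0 violations anywhere, AN-33j data law 42 279/42 279).
AN-33f SURVIVES (carries the binder; odd-witness normalisation of u sound); AN-33g/h/i SURVIVE (conjecture-grade BSD₂-shadows, even-Tam immune).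
Riders: r1 (BLOCKING, applied in THIS file — the two decls below ARE the repaired C′), r2 (tags: AN-33b/c/j plain def + `_holds`; AN-33d–i
`@[conjecture]`; `DoorValueSupplyAtTwo` documented plain binder-name), r3 (-an: 446a1 bookkeeping rows as the in-habitat illustration of r1; keep
`ShaTwoTrivial` flagged untested-on-slice).»  PARTITION none; beyond-print: no (b/c/j kernel-checked, REF2 v33); BSD not proved.
REF2-PLACEMENT v33 (refuter-bsd-f1-sign2-ref2 g33, 2026-08-28T15:32:04Z; `HOME/REF2-PLACEMENT-v33.md` ec42c5f23fc45871; D-an-74, D-an-74⁺, D-an-73-upgraded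
ANSWERED): «(1) AN-33b/c (the imported §2 file): statements VARIANT, proof mechanism IN PRINT (Mazur–Tate 1987 norm relation read mod 2u on the minus
side + half-system lemma + Zhai 2016's mod-2 step) ⇒ IN-PRINT-ASSEMBLY, beyond-print no, kernel-checked yes; (2) AN-33h/i at the SELMER level KNOWN
VERBATIM: Klagsbrun–Mazur–Rubin 2014 (Compositio 150) §‹Changing Selmer ranks› Prop. (ii) (𝒫₁ = transposition primes: class-blind) and (iii) (𝒫₂ =
identity primes, t = 0: +2 for exactly one of the two ramified characters = the DICHOTOMY); mechanism = loc_ℓ Sel^{(ℓ)} Lagrangian by Poitou–Tate +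
count of ramified Lagrangians = -an's «Lagrangian ruling» (Poonen–Rains 2012 Prop 4.10, Thm 4.13 framing); proviso: the two classes must fix the same
local characters off ℓ; value-level 33d–33i = KNOWN Selmer law + rank-0 BSD₂ shadow ⇒ conjecture-grade VARIANT; D-an-76⁺ Lagrangian-ruling lemma = port
KMR's proof (KNOWN if landed); (3) AN-33a supply, value corollary over pure-3-cycle doors: Zhai 2016 Thm 1.1, 1.2 on the rank-0 twin — VARIANT (v32 §3).»
REF2 v35 §1.5 rider r3 (refuter-bsd-f1-sign2-ref2 g35, 2026-08-28T16:23:44Z; a census ask to -an, recorded for the value laws here): «ROOT-NUMBER CONSISTENCY LAW: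
w(E^{(d)}) = −w(E)·∏_{q∣m}(N/q) on the family + Čebotarev ⇒ η_f = 1 forces sign(Δ_E) = −w(E) AND sqfree|Δ_E| = sqfree(N) (37a1, 229a1 ✓; 43a1/53a1/61a1
Δ<0, w = −1 ⇒ η = 0 forced); add the column «sign Δ · w · [N′ = Δ′]» to P33.»
[cite: KlagsbrunMazurRubin2014, §Changing Selmer ranks] [cite: Zhai2016, Thm. 1.1] [cite: MazurTate1987, §1]
PARTITION: none moved (frontier tier); beyond-print theorem: no (AN-33b, AN-33c kernel theorems = IN-PRINT-ASSEMBLY per REF2 v33; AN-33d–i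
conjecture-grade VARIANT of a KNOWN Selmer law).  BSD is not proved; 23715 not closed.
bears_on: 23715 (`ByReductionTypeAtTwo.RankOneAtTwoBigImageOddLocal`; line v8.x `missingUpperBoundAt_two_onSlice_…_of_doorValueSupply`, lead
fkl-p1, fkl-p2; crux idea `unit-door-parity-bit`); asks D-an-72 (-ty, this file), D-an-73 (REF1), D-an-74, D-an-74⁺ (REF2), D-an-75 (-data),
D-an-76, D-an-76⁺ (-desc, -es).

## The sketch's own summary (verbatim)

# Cell `bsd-f1-sign2`, lens `-an` g16 (MEMO-an v1.27 §2 AN-33): DOOR-VALUE SUPPLY AT TWO, THE MINUS HALF-SUM PROPORTIONALITY MOD 2,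
# AND THE UNIT-DOOR VALUE LAWS (sketch v27; statements + proved plumbing + §5 KERNEL PROOFS of AN-33b (every odd level) and AN-33c + §6–§7 KERNEL PROOF of AN-33j, the composite-door symbol law; nothing else asserted; BSD is not proved by any of this)

* §1 `DoorValueSupplyAtTwo` — the hypothesis `hSup` of the kernel theorem
  `RankOneAtTwoOneDoor.missingUpperBoundAt_two_onSlice_of_doorIndexLawUpperCAtTwo_of_doorValueSupply` (lead fkl-p2 g9, crux 23715 line v8.6)
  TYPED BY NAME, verbatim; `DoorUnitValueAt W d` its per-door predicate; glue `missingUpperBoundAt_two_onSlice_of_doorValueSupplyAtTwo`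
  (U + supply ⇒ the Euler-system half of `BSD₂(W)` on the whole slice, NO rank-0 `BSD₂` input) — one line over the kernel theorem.
* §2 THEOREM-CANDIDATES (pure modular symbols; any newform with rational coefficients; no sign / rank / `L(f,1)` hypothesis):
  `minusHalfSum f m = F_m := ∑_{k=1}^{(m−1)/2} [k/m]⁻_f`; `MinusHalfSumHeckeStepModTwo`: `F_{qm} ≡ (a_q − 1)·F_m + F_q (mod 2u)` for `m` odd,
  `q` an odd prime, `q ∤ N`, `q ∤ m`, and any `u > 0` with `[·]⁻_f ⊂ uℤ`; `MinusHalfSumProportionalityModTwo`: `a_{q'}·F_q ≡ a_q·F_{q'} (mod 2u)`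
  for distinct odd primes `q, q' ∤ N`.  Hence ONE BIT `η_f ∈ {0,1}` with `F_q ≡ η_f·a_q·u (mod 2u)` for every odd prime `q ∤ N` (as soon as one
  `a_q` is odd): the half-sums are ODD multiples of the symbol unit at ALL `3`-cycle primes or at NONE, and EVEN at every transposition /
  identity prime.  Proof on paper (≤ 1 p.): the tree's Hecke relation `intCast_mul_ratMinusSymbol`, periodicity `ratMinusSymbol_add_intCast`,
  oddness `ratMinusSymbol_neg`, and the HALF-SYSTEM LEMMA (a sum of an odd `uℤ`-valued function over any half-system of residues is
  well defined mod `2u`).  By Birch's formula (`ratMinusTwistedSymbolSum_mul_minusPeriod_mul_I`) and the half-system lemma,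
  `∑_{0<k<|d|/2} χ_d(k)[k/|d|]⁻ ≡ T'_{|d|} (mod 2u)`, so `η_f` is the common parity (in symbol units) of the algebraic central values of ALL
  imaginary quadratic twists by pure-`3`-cycle doors — the regime Zhai 2016 Thm 1.2 / Zhai 2021 Rem. 1.4 exclude (`Δ_E > 0`, `M < 0`).
* §2 (v27) `minusHalfSumUnits f m = F×_m` (units-only half-sum) and **AN-33j `MinusUnitHalfSumPureCycleLaw` (PROVED, §6–§7)**: for square-free odd `m`
  with all prime factors `∤ N`, `F×_m ≡ η_f·[m > 1 ∧ every prime factor of m is a 3-cycle prime]·u (mod 2u)` — the composite-door symbol law.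
* §3 CONJECTURES (BSD₂-shadows; the VALUE side of the tree's Selmer laws T-C `EggTwistLawAtTwo` and T-q₀ `TranspositionTwistLawAtTwo`):
  `EggUnitDoorValueLawAtTwo` (`Δ > 0`: a pure-`3`-cycle door is a unit door iff `E(ℚ)` meets the egg) and `TranspositionUnitDoorValueLawAtTwo`
  (`Δ < 0`: a one-transposition door `(d, q₀)` is a unit door iff `E(ℚ)` meets the non-norm coset at `q₀`), both on `{rank 1, E(ℚ)[2] = 0,
  Ш(E)[2] = 0}`.  With §2 the first says `η_{f_W} = [MeetsEgg W]` on `{Δ > 0, Ш[2] = 0, ∏c odd}`.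
* §3 (ctd.) `SilentTransportUnitDoorValueLawAtTwo` (AN-33g; post-run refinement of P33.6: twist by a `3`-cycle `q ≡ 1 (8)` locally square at the
  non-silent primes of `d` preserves unit-ness; 284/284).
* §3 (ctd.) `NonSilentClassUnitDoorValueLawAtTwo` (AN-33h: transposition primes are class-blind, identity primes are not; 10 387/10 387) and
  `IdentityPrimeDichotomyUnitDoorValueLawAtTwo` (AN-33i: adjoining an identity prime to a UNIT door gives exactly one unit door among the two classes;
  128/128 dichotomy, 30/30 class-blind; Lagrangian-spread mechanism).
* §4 proved plumbing: `doorValueSupplyAtTwo_iff`, the glue of §1, `doorUnitValueAt_of_eggLaw` (supply on the egg branch from §3).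

Census = ENGINE U (kit `bsd-frontier-data` j310561–3, `MEMO-an-data/g16/jobU/`); nearest print Zhai 2016 (arXiv:1409.0231) Thms 1.1–1.5,
Zhai 2021 (arXiv:2102.11798) Thm 1.1 + Rem. 1.4, Cai–Li–Zhai 2020 (arXiv:1712.01271), Kriz–Li 2019 (arXiv:1606.03172), Mazur–Rubin 2010.
-/

set_option autoImplicit false

noncomputable section

open scoped Classical MatrixGroups ModularForm

open CongruenceSubgroup WeierstrassCurve NumberField Literature.NumberTheory.EllipticCurves Literature.NumberTheory.EllipticCurves.ModularForms
  Literature.NumberTheory.EllipticCurves.Rank1Residual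
  Literature.NumberTheory.EllipticCurves.Rank1Residual.Typed
  Summit.BirchSwinnertonDyer.Rank1Residual
  Summit.BirchSwinnertonDyer.Rank1Residual.F1Sign2
  Summit.BirchSwinnertonDyer.Rank1Residual.F1Sign2.TranspositionDoor
  Summit.BirchSwinnertonDyer.BirchSwinnertonDyer.Theorems.RankOneAtTwoOneDoor

namespace Summit.BirchSwinnertonDyer.Rank1Residual.F1Sign2.ANg16

/-! ### §1 Door-value supply (the kernel theorem's `hSup`, typed by name) -/

/-- `d` is a UNIT DOOR of `W` in value currency: `L(W^{(d)},1) ≠ 0` and some globally minimal model `Wd` of the twist has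
`ord₂ (L(Wd,1)/Ω(Wd)) ≤ t + 2s` (`BSD₂(Wd)` on the slice: `= t + 2s + ord₂ #Ш(Wd)[2^∞]`, so `≤` means `Ш(Wd)[2] = 0`). -/
def DoorUnitValueAt (W : WeierstrassCurve ℚ) [W.IsGloballyMinimal] (d : ℤ) : Prop :=
  (W.quadraticTwist (d : ℚ)).entireLFunction 1 ≠ 0 ∧
    ∃ (Wd : WeierstrassCurve ℚ) (_ : Wd.IsElliptic) (_ : Wd.IsGloballyMinimal) (Cd : VariableChange ℚ) (qd : ℚ),
      Cd • W.quadraticTwist (d : ℚ) = Wd ∧ Wd.entireLFunction 1 / (Wd.realPeriodRat : ℂ) = (qd : ℂ) ∧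
      padicValRat 2 qd ≤ transpCount W d + 2 * identCount W d

/-- **AN-33a `DoorValueSupplyAtTwo` (= `hSup` of the kernel theorem, VERBATIM).**  Every curve on the slice (globally minimal, non-CM,
surjective mod `2^n` for all `n`, odd torsion, odd Tamagawa product, analytic rank one) has an imaginary quadratic `K` whose discriminant is a
door-admissible UNIT DOOR.  Conjecture-grade (⟸ Mazur–Rubin `Sel₂`-trivialising door supply + rank-`0` `BSD₂` exactness for `Sel₂`-trivial
twins at `2`); rank-`0`-base analogue in print: Zhai 2016 Thm 1.1 (`Δ<0`) / Thm 1.5 (`Δ>0`, `M>0` only).  Why it might fail: a slice curve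
all of whose door twins with `L ≠ 0` carry `Ш(Wd)[2] ≠ 0` (excluded by BSD₂ + MR supply, not by any theorem at `2`).
REF1 §122: «T1 `DoorValueSupplyAtTwo` SURVIVES (= kernel `hSup` by `rfl`; glue identity; bookkeeping-grade)»; r2: kept a PLAIN binder-name `def`
(it is CHARACTER FOR CHARACTER the `hSup` hypothesis of the tree theorem `RankOneAtTwoOneDoor.missingUpperBoundAt_two_onSlice_of_doorIndexLawUpperCAtTwo_of_doorValueSupply`,
documented as such; the gate's advisory audit classes an untagged `def : Prop` as vendored-fact — this is a NAME for an existing binder, not a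
Literature fact).  REF2 v32 §3 / v33: value corollary over pure-3-cycle doors = Zhai 2016 Thm 1.1/1.2 on the rank-0 twin — VARIANT. -/
def DoorValueSupplyAtTwo : Prop :=
  ∀ (W : WeierstrassCurve ℚ) [W.IsElliptic] [W.IsGloballyMinimal] [NeZero (W.conductorNorm ℤ)],
    ¬ W.HasCM → (∀ n : ℕ, W.HasSurjectiveModNGaloisRep ((2 ^ n : ℕ) : ℤ)) → Odd W.torsionOrder → Odd W.tamagawaProduct →
    W.analyticRank = 1 →
    ∃ (K : Type) (_ : Field K) (_ : NumberField K), IsImaginaryQuadratic K ∧ DoorAdmissible W (NumberField.discr K) ∧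
      (W.quadraticTwist (NumberField.discr K : ℚ)).entireLFunction 1 ≠ 0 ∧
      ∃ (Wd : WeierstrassCurve ℚ) (_ : Wd.IsElliptic) (_ : Wd.IsGloballyMinimal) (Cd : VariableChange ℚ) (qd : ℚ),
        Cd • W.quadraticTwist (NumberField.discr K : ℚ) = Wd ∧ Wd.entireLFunction 1 / (Wd.realPeriodRat : ℂ) = (qd : ℂ) ∧
        padicValRat 2 qd ≤ transpCount W (NumberField.discr K) + 2 * identCount W (NumberField.discr K)

/-- `DoorValueSupplyAtTwo` is «every slice curve has a door-admissible unit door `d_K`» (definitional). -/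
theorem doorValueSupplyAtTwo_iff :
    DoorValueSupplyAtTwo ↔
      ∀ (W : WeierstrassCurve ℚ) [W.IsElliptic] [W.IsGloballyMinimal] [NeZero (W.conductorNorm ℤ)],
        ¬ W.HasCM → (∀ n : ℕ, W.HasSurjectiveModNGaloisRep ((2 ^ n : ℕ) : ℤ)) → Odd W.torsionOrder → Odd W.tamagawaProduct →
        W.analyticRank = 1 →
        ∃ (K : Type) (_ : Field K) (_ : NumberField K), IsImaginaryQuadratic K ∧ DoorAdmissible W (NumberField.discr K) ∧
          DoorUnitValueAt W (NumberField.discr K) :=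
  Iff.rfl

/-- **Glue (proved): U + door-value supply + the four primary facts ⇒ the Euler-system half of `BSD₂(W)` on the whole slice**, by the
kernel theorem `missingUpperBoundAt_two_onSlice_of_doorIndexLawUpperCAtTwo_of_doorValueSupply` (no rank-`0` `BSD₂` input). -/
theorem missingUpperBoundAt_two_onSlice_of_doorValueSupplyAtTwo
    (hGZ : ∀ (N : ℕ) [NeZero N] (W : WeierstrassCurve ℚ) (K : Type) [Field K] [NumberField K], gross_zagier N W K)
    (hKo : ∀ (N : ℕ) [NeZero N] (W : WeierstrassCurve ℚ) (K : Type) [Field K] [NumberField K], kolyvagin N W K)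
    (hGZK : rank_eq_analyticRank_of_analyticRank_le_one) (hnf : exists_isNewformOf) (hU : DoorIndexLawUpperCAtTwo)
    (hSup : DoorValueSupplyAtTwo) :
    ∀ (W : WeierstrassCurve ℚ) [W.IsElliptic] [W.IsGloballyMinimal], ¬ W.HasCM →
      (∀ n : ℕ, W.HasSurjectiveModNGaloisRep ((2 ^ n : ℕ) : ℤ)) → Odd W.torsionOrder → Odd W.tamagawaProduct →
      W.analyticRank = 1 → MissingUpperBoundAt W 2 :=
  missingUpperBoundAt_two_onSlice_of_doorIndexLawUpperCAtTwo_of_doorValueSupply hGZ hKo hGZK hnf hU hSup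

/-! ### §3 The unit-door value laws (CONJECTURES; the value side of T-C / T-q₀) -/

/-- **AN-33d `EggUnitDoorValueLawAtTwo` (CONJECTURE; BSD₂-shadow of T-C `EggTwistLawAtTwo`).**  `W` globally minimal, non-CM, `Δ_W > 0`,
`E(ℚ)[2] = 0`, rank one, `Ш(W)[2] = 0`; `d` door-admissible with NO transposition / identity prime (`t = s = 0`): `d` is a unit door iff
`E(ℚ)` meets the egg.  (⟸ T-C [Mazur–Rubin at `v = ∞`: `Sel₂(W^{(d)}) = 0` iff egg] + rank-`0` `BSD₂(W_d)` [unit iff `Sel₂ = 0`]; the «only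
if» half is the Euler-system direction at `2` [Kato], the «if» half the `2`-converse for `Sel₂`-trivial twins — Zhai 2016's shape with a
rank-ONE base, not in print: Zhai 2021 Rem. 1.4 excludes `Δ > 0`, `M < 0`.)  Why it might fail: only through one of those two halves;
census ENGINE U P33.4 (full run j310561–3: `η_W = egg` on 611/611 `Δ>0` slice curves; pure-`3`-cycle doors (unit, egg) = (T,1) 3 125 / (F,0) 553 / else 0;
symbol doors 6 248 / 1 225 / 0; every input has `Ш_an(W) = 1`, so `ShaTwoTrivial` is untested here).
REF1 §122 (refuter-bsd-f1-sign2-ref1 g11, 2026-08-28T16:01:50Z; REPAIR C′ = rider r1, applied here by -ty g11): «Hypothesis `Odd W.tamagawaProduct` is load-bearing: by BSD₂ bookkeeping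
ord₂(L(W_d,1)/Ω(W_d)) ≥ ord₂ ∏c(W) + t + 2s, so at even Tamagawa product no door is a unit door (REF1 §122, kit j311923: 158b1, 392f1, …; 57a1, 58a1, …).»  As typed
WITHOUT it (MEMO-an Sketch_v24–v29) the decl was KILLED AS TYPED (refuted-misstated, 30+30 counter-instances on 20 even-Tamagawa curves); the repaired
C′ (this text = REF1's `Probe122.lean` decl `…OddTam` under the original name) SURVIVES the census (P33.4 3 125/562/0, 608/608; P33.5 6 693/3 948/0;
replay122 9aab19e60517180f, 0 violations). -/
@[conjecture] def EggUnitDoorValueLawAtTwo : Prop :=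
  ∀ (W : WeierstrassCurve ℚ) [W.IsElliptic] [W.IsGloballyMinimal], ¬ W.HasCM → 0 < W.Δ → NoRationalTwoTorsion W →
    W.mordellWeilRank = 1 → ShaTwoTrivial W → Odd W.tamagawaProduct →
    ∀ d : ℤ, DoorAdmissible W d → transpCount W d = 0 → identCount W d = 0 → (DoorUnitValueAt W d ↔ MeetsEgg W)

/-- **AN-33e `TranspositionUnitDoorValueLawAtTwo` (CONJECTURE; BSD₂-shadow of T-q₀ `TranspositionTwistLawAtTwo` = the value form of
AN-22K `TranspositionDoorLawAtTwo`).**  `W` globally minimal, non-CM, `Δ_W < 0`, `E(ℚ)[2] = 0`, rank one, `Ш(W)[2] = 0`; `(d, q₀)`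
transposition-admissible (one transposition prime `q₀`, all other door primes `3`-cycles): `d` is a unit door (`ord₂ q_d ≤ 1`) iff `E(ℚ)`
meets the non-norm coset at `q₀` (`P̃₀ ∉ 2Ẽ(𝔽_{q₀})`).  Why it might fail: as AN-33d (T-q₀ + the two halves of rank-`0` `BSD₂(W_d)` at `2`);
census ENGINE U P33.5 (full run j310561–3: two-engine doors (unit, bit) = (T,1) 6 693 / (F,0) 3 948 / else 0; symbol doors 14 155 / 9 318 / 0;
bit consistent on 19 233 `(W,q₀)` groups).
REF1 §122 (refuter-bsd-f1-sign2-ref1 g11, 2026-08-28T16:01:50Z; REPAIR C′ = rider r1, applied here by -ty g11): «Hypothesis `Odd W.tamagawaProduct` is load-bearing: by BSD₂ bookkeeping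
ord₂(L(W_d,1)/Ω(W_d)) ≥ ord₂ ∏c(W) + t + 2s, so at even Tamagawa product no door is a unit door (REF1 §122, kit j311923: 158b1, 392f1, …; 57a1, 58a1, …).»  As typed
WITHOUT it (MEMO-an Sketch_v24–v29) the decl was KILLED AS TYPED (refuted-misstated, 30+30 counter-instances on 20 even-Tamagawa curves); the repaired
C′ (this text = REF1's `Probe122.lean` decl `…OddTam` under the original name) SURVIVES the census (P33.4 3 125/562/0, 608/608; P33.5 6 693/3 948/0;
replay122 9aab19e60517180f, 0 violations). -/
@[conjecture] def TranspositionUnitDoorValueLawAtTwo : Prop :=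
  ∀ (W : WeierstrassCurve ℚ) [W.IsElliptic] [W.IsGloballyMinimal], ¬ W.HasCM → W.Δ < 0 → NoRationalTwoTorsion W →
    W.mordellWeilRank = 1 → ShaTwoTrivial W → Odd W.tamagawaProduct →
    ∀ (d : ℤ) (q₀ : ℕ) [Fact q₀.Prime], TranspAdmissible W d q₀ → (DoorUnitValueAt W d ↔ MeetsNonNormAt W q₀)

/-- **AN-33f `EggSymbolParityLawAtTwo` (CONJECTURE joining §2 and §3; the SYMBOL form of the egg law).**  On `{Δ > 0, E(ℚ)[2] = 0, rank 1,
Ш[2] = 0, ∏c odd}` with a modular parametrisation of ODD Manin constant and a symbol unit `u` witnessed by an odd multiple: for every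
`3`-cycle prime `q ∤ 2N` the half-sum `F_q/u` is ODD iff `E(ℚ)` meets the egg — `η_{f_W} = [MeetsEgg W]`.  (⟸ AN-33c + AN-33d + Birch's
formula + the minimal-twist period relation; the new content over AN-33d is that ONE modular-symbol parity decides all pure-`3`-cycle doors.)
Why it might fail: through AN-33d, or an even Manin/lattice index spoiling the unit calibration (excluded by `Odd Dt.c` and the odd witness). -/
@[conjecture] def EggSymbolParityLawAtTwo : Prop :=
  ∀ (W : WeierstrassCurve ℚ) [W.IsElliptic] [W.IsGloballyMinimal] [NeZero (W.conductorNorm ℤ)], ¬ W.HasCM → 0 < W.Δ →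
    NoRationalTwoTorsion W → W.mordellWeilRank = 1 → ShaTwoTrivial W → Odd W.tamagawaProduct →
    ∀ (Dt : ModularParametrizationData W (W.conductorNorm ℤ)), Odd Dt.c →
    ∀ (u : ℚ), IsMinusSymbolUnit Dt.f u → (∃ (r : ℚ) (z : ℤ), Odd z ∧ ratMinusSymbol Dt.f r = z * u) →
    ∀ (q : ℕ), q.Prime → Odd q → ¬ (q : ℤ) ∣ (W.conductorNorm ℤ : ℤ) → Odd (W.frobeniusTrace q) →
      ((∃ z : ℤ, Odd z ∧ minusHalfSum Dt.f q = z * u) ↔ MeetsEgg W)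

/-- **AN-33g `SilentTransportUnitDoorValueLawAtTwo` (CONJECTURE, found AFTER the full run — exploratory refinement of P33.6; BSD₂-shadow of
Mazur–Rubin's «twist by a character locally trivial on Σ leaves `Sel₂` unchanged»).**  `W` globally minimal, non-CM, `E(ℚ)[2] = 0`, rank one,
`Ш(W)[2] = 0`; `d` and `d·q` door-admissible with `q ≡ 1 (mod 8)` a `3`-cycle prime (`a_q` odd) that is a SQUARE modulo every non-silent prime of `d`
(every `p ∣ d` with `a_p` even): then `d` is a unit door iff `d·q` is.  (`q ≡ 1 (8)` ⟹ square in `ℚ₂`; `q > 0` ⟹ trivial at `∞`; `(q/ℓ) = 1` at the bad `ℓ`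
is forced by door-admissibility of both; so `W^{(dq)}` and `W^{(d)}` have the same local Kummer conditions at every place except the silent `q`,
where `H¹(ℚ_q, E[2]) = 0`.)  Census ENGINE U (C): locally-square pairs 284/284 equal unit bits (118 at `Δ<0`, 166 at `Δ>0`); NOT locally square:
35 flips / 390.  Why it might fail: only through the rank-`0` `BSD₂`-shadow (unit ⟺ `Sel₂ = 0`) — the Selmer equality itself is Galois cohomology. -/
@[conjecture] def SilentTransportUnitDoorValueLawAtTwo : Prop :=
  ∀ (W : WeierstrassCurve ℚ) [W.IsElliptic] [W.IsGloballyMinimal], ¬ W.HasCM → NoRationalTwoTorsion W → W.mordellWeilRank = 1 →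
    ShaTwoTrivial W →
    ∀ (d : ℤ) (q : ℕ), q.Prime → q % 8 = 1 → Odd (W.frobeniusTrace q) →
      (∀ p : ℕ, p.Prime → (p : ℤ) ∣ d → Even (W.frobeniusTrace p) → jacobiSym q p = 1) →
      DoorAdmissible W d → DoorAdmissible W (d * q) → (DoorUnitValueAt W d ↔ DoorUnitValueAt W (d * q))

/-- **AN-33h `NonSilentClassUnitDoorValueLawAtTwo` (CONJECTURE in value currency; Selmer version = identical local conditions; found AFTER the run).**
Two door-admissible `d, d'` of `W` with the SAME non-silent primes (the `p` with `a_p` even) whose ratio is a square modulo every IDENTITY prime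
(`a_p` even and `(Δ_W / p) = 1`, i.e. `E[2] ⊂ E(𝔽_p)`) have the same unit bit — NO condition at the TRANSPOSITION primes (`a_p` even, `(Δ_W/p) = -1`):
there `ℚ_p(E[2]) = ℚ_{p²}` absorbs the non-square unit, so the two ramified Kummer lines coincide.  Generalises AN-33g.  Census ENGINE U (H2):
10 387/10 387 pairs equal (5 482 of them NON-square at a transposition prime); pairs non-square at an identity prime: 395/479 FLIP (see AN-33i).
REF2 v33 §2: Selmer level KNOWN verbatim (Klagsbrun–Mazur–Rubin 2014 Prop. (ii): transposition primes 𝒫₁ are class-blind); value level = that + rank-0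
BSD₂ shadow, conjecture-grade VARIANT; beyond-print no. [cite: KlagsbrunMazurRubin2014, §Changing Selmer ranks, Prop. (ii)] -/
@[conjecture] def NonSilentClassUnitDoorValueLawAtTwo : Prop :=
  ∀ (W : WeierstrassCurve ℚ) [W.IsElliptic] [W.IsGloballyMinimal], ¬ W.HasCM → NoRationalTwoTorsion W → W.mordellWeilRank = 1 →
    ShaTwoTrivial W →
    ∀ (d d' : ℤ), DoorAdmissible W d → DoorAdmissible W d' →
      (∀ p : ℕ, p.Prime → Even (W.frobeniusTrace p) → ((p : ℤ) ∣ d ↔ (p : ℤ) ∣ d')) →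
      (∀ p : ℕ, p.Prime → (p : ℤ) ∣ d → Even (W.frobeniusTrace p) → jacobiSym W.Δ.num p = 1 →
          jacobiSym ((d / p) * (d' / p)) p = 1) →
      (DoorUnitValueAt W d ↔ DoorUnitValueAt W d')

/-- **AN-33i `IdentityPrimeDichotomyUnitDoorValueLawAtTwo` (CONJECTURE in value currency; found AFTER the run, then PRE-STATED and confirmed on the
`Δ<0` rows (H3): 24/24 + 7/7).**  `d₀` door-admissible WITHOUT identity primes, `p ∤ d₀` an identity prime, `dᵢ = d₀·p·mᵢ` (`i = 1,2`) door-admissible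
with `mᵢ > 0` composed of `3`-cycle primes and `m₁m₂` a NON-square mod `p` (the two ramified classes at `p`).  Then: if `d₀` is a unit door,
EXACTLY ONE of `d₁, d₂` is a unit door; if not, `d₁, d₂` have the same unit bit.  Selmer mechanism (theorem-grade, ≈ 1 page): at an identity prime
`H¹(ℚ_p, E[2])` is `4`-dimensional and `{L_ur, L^{d₁}, L^{d₂}}` is a complete family of pairwise-transverse Lagrangians; reducing the global
Lagrangian along the (common) conditions elsewhere gives a Lagrangian `Λ_red ⊂ H¹(ℚ_p, E[2])` with `dim Sel₂(W^{d₀}) = dim K + dim (Λ_red ∩ L_ur)`,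
`dim Sel₂(W^{dᵢ}) = dim K + dim (Λ_red ∩ L^{dᵢ})`; `Sel₂(W^{d₀}) = 0` forces `K = 0`, `Λ_red ∈ {L^{d₁}, L^{d₂}}`, hence `{dim Sel₂(W^{d₁}), dim Sel₂(W^{d₂})}
= {0, 2}`.  Census ENGINE U: dichotomy 104/104 (`Δ>0` egg curves, `p` the only non-silent prime) + 24/24 (`Δ<0`, `d₀`-part a unit minimal door,
`b = 1`); class-blind when `d₀` is non-unit: 23/23 (`egg = 0`) + 7/7 (`b = 0`).  Why it might fail: value currency only via the `BSD₂`-shadow; as typed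
the auxiliary `d₀` must itself be admissible (the data instances realise `d₀`'s Selmer structure, not always an admissible integer `d₀`).
REF2 v33 §2 (refuter-bsd-f1-sign2-ref2 g33, 2026-08-28T15:32:04Z): «Selmer level KNOWN verbatim — Klagsbrun–Mazur–Rubin 2014 (Compositio 150) §‹Changing Selmer
ranks› Prop. (ii) (𝒫₁: class-blind ±1) and (iii) (𝒫₂, t = 0: +2 for exactly one of the two ramified characters at p = 2); value level = that + rank-0
BSD₂ shadow, conjecture-grade VARIANT; beyond-print no.» (proviso: the two classes must induce the SAME local characters off the door prime.)
[cite: KlagsbrunMazurRubin2014, §Changing Selmer ranks, Prop. (ii), (iii)] -/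
@[conjecture] def IdentityPrimeDichotomyUnitDoorValueLawAtTwo : Prop :=
  ∀ (W : WeierstrassCurve ℚ) [W.IsElliptic] [W.IsGloballyMinimal], ¬ W.HasCM → NoRationalTwoTorsion W → W.mordellWeilRank = 1 →
    ShaTwoTrivial W →
    ∀ (d₀ : ℤ) (p m₁ m₂ : ℕ), DoorAdmissible W d₀ → identCount W d₀ = 0 →
      p.Prime → ¬ (p : ℤ) ∣ d₀ → Even (W.frobeniusTrace p) → jacobiSym W.Δ.num p = 1 →
      0 < m₁ → 0 < m₂ → (∀ ℓ : ℕ, ℓ.Prime → ℓ ∣ m₁ * m₂ → Odd (W.frobeniusTrace ℓ)) → jacobiSym ((m₁ * m₂ : ℕ) : ℤ) p = -1 →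
      DoorAdmissible W (d₀ * p * m₁) → DoorAdmissible W (d₀ * p * m₂) →
      (DoorUnitValueAt W d₀ → (DoorUnitValueAt W (d₀ * p * m₁) ↔ ¬ DoorUnitValueAt W (d₀ * p * m₂))) ∧
      (¬ DoorUnitValueAt W d₀ → (DoorUnitValueAt W (d₀ * p * m₁) ↔ DoorUnitValueAt W (d₀ * p * m₂)))

/-! ### §4 Proved plumbing: supply on the egg branch -/

/-- On the egg branch of `{Δ > 0, Ш[2] = 0, ∏c odd}` (REF1 §122 r1: `(hc : Odd W.tamagawaProduct)` threaded) the egg law turns ANY pure-`3`-cycle door into a unit door (so door-value supply there is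
reduced to the existence of one door-admissible pure-`3`-cycle `d_K` — Chebotarev, AN-22J). -/
theorem doorUnitValueAt_of_eggLaw (h : EggUnitDoorValueLawAtTwo) (W : WeierstrassCurve ℚ) [W.IsElliptic] [W.IsGloballyMinimal]
    (hCM : ¬ W.HasCM) (hΔ : 0 < W.Δ) (h2 : NoRationalTwoTorsion W) (hr : W.mordellWeilRank = 1) (hSha : ShaTwoTrivial W)
    (hc : Odd W.tamagawaProduct) (hegg : MeetsEgg W) {d : ℤ} (hd : DoorAdmissible W d) (ht : transpCount W d = 0)
    (hs : identCount W d = 0) : DoorUnitValueAt W d :=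
  (h W hCM hΔ h2 hr hSha hc d hd ht hs).2 hegg

/-- Dually on the non-norm branch at `Δ < 0` (REF1 §122 r1: `(hc : Odd W.tamagawaProduct)` threaded). -/
theorem doorUnitValueAt_of_transpositionLaw (h : TranspositionUnitDoorValueLawAtTwo) (W : WeierstrassCurve ℚ) [W.IsElliptic]
    [W.IsGloballyMinimal] (hCM : ¬ W.HasCM) (hΔ : W.Δ < 0) (h2 : NoRationalTwoTorsion W) (hr : W.mordellWeilRank = 1)
    (hSha : ShaTwoTrivial W) (hc : Odd W.tamagawaProduct) {d : ℤ} {q₀ : ℕ} [Fact q₀.Prime] (hd : TranspAdmissible W d q₀)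
    (hnn : MeetsNonNormAt W q₀) : DoorUnitValueAt W d :=
  (h W hCM hΔ h2 hr hSha hc d q₀ hd).2 hnn

/-! ### §3⁺ (v29–v37) The canonical parity-bit laws on the EGG sub-slice: AN-33p / p′ / p″ / p‴ (CONJECTURES, repaired C′)

TYPER APPEND (-ty g11; -an g16 PORT FILE `MEMO-an-data/g16/Sketch_v37.lean` 454eaaa5b944aeb6 §3 residue VERBATIM — the four `@[conjecture]` laws
WITH BOTH binders `MeetsEgg W →` (REF1 §126 / REF2 v36 r4 repair C′) and `ShaTwoTrivial W →` (REF2 v36's BSD₂-consistency binder, adopted by -an v36)).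
REF1 §126 (refuter-bsd-f1-sign2-ref1 g11, 2026-08-28T17:18:39Z; `REF1-AUDIT-v1.md` l.2473, evidence `REF1-data/b126/`, kit j313327 Sage/eclib 611/611
curves): «D-an-79/82/84 ANSWERED — AN-33p well-posed (∃u ⟺ v₂(F_{q₀}) = v₂(u_max); κ = k/c ∈ ℚ^× determined), AN-33w sound, AN-33y sound; 29/29 new
theorems std axioms; BUT AN-33p `EggPeriodIndexLawAtTwo`, p′ `EggHalfOddSymbolLawAtTwo`, p″ `EggEtaOneLawAtTwo`, p‴ `EggTwiceHalfSumOddLawAtTwo` KILLED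
AS TYPED in v29–v33 (refuted-misstated): none carried `MeetsEgg W` — the 611 Δ>0 slice curves of ENGINE U = 516 egg (η = 1) + 95 NON-EGG with η = 0;
witness W = 359a1 = [1,0,1,−23,39] (N = 359 prime, good at 2, tors 1, Tam 1, non-CM, Δ > 0, rank 1, generator (3,−1) on the identity component,
2-adic image surjective): F_5 = −2, F_7 = 2, F_17 = 2, F_19 = 4, F_31 = 8 ⇒ 2F_{q₀} EVEN at every 3-cycle prime; non-egg 95/95 η = 0, egg 516/516
η = 1; repair C′ = insert `MeetsEgg W →` after `0 < W.Δ →` (Probe126/126B rc 0: a weakening, glue verbatim) — with C′ all four SURVIVE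
conjecture-grade (516/516); 6 egg inputs (4050a1, 6050q1, 6962m1, 11858j1, 16200z1, 19602q1) have Δ ∈ 2·ℚ^{×2} ⇒ ρ̄₈ not surjective ⇒ outside the
∀n-surjective slice (O-REF1-126a); GATE: do NOT file without `MeetsEgg W`» — satisfied below.  REF2 v36 §1 / §1.3 r4 (refuter-bsd-f1-sign2-ref2 g36,
2026-08-28T17:12:00Z; `HOME/REF2-PLACEMENT-v36.md` 1e3208ab5dfaaa36): same kill and C′ independently (+ the `ShaTwoTrivial W` binder: egg ∧ Ш(W)[2] =
(ℤ/2)² ⇒ at doors d ≡ 1 (8) no unit door ⇒ η = 0; ENGINE U blind, all inputs Ш_an = 1); placement of C′: NOT IN PRINT; descent shadow KNOWN (Kramer 1981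
Prop 6); analytic content = rank-0 2-converse / BSD₂ at p = 2 for Sel₂-trivial big-image twists, OPEN in print (Kriz–Li 2019 Rem 1.14) ⇒ a proof of
C′ would be beyond print, today no; printed sufficient condition for η_f = 1: Kriz–Li (⋆) + BSD(2) at the seed door; AN-33t/w/y per-door bookkeeping
KNOWN (Cremona 1997 §2.11 m⁻(l,f); GV 2000 Rem 3.4 / Abbes–Ullmo / Česnavičius; Pal 2012 Prop 2.5), the door-independence / unit-from-the-bit
sentences NOT IN PRINT verbatim — nearest Kriz–Li 2019 Thm 5.1(2) + L.5.12 + Ex. 6.1 (37a1: a printed theorem-instance), Zhai 2016 Thm 1.2, Ono 2001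
Crelle 533 Thm 3.5; VARIANT; beyond-print no.  The PROVED plumbing among p/p′/p″/p‴ (`eggHalfOddSymbolLawAtTwo_of_eggEtaOneLaw`,
`eggTwiceHalfSumOddLawAtTwo_of_eggEtaOneLaw`, AN-33q/r/u/x/s…) lands in the proofs siblings `F1Sign2/TwistPeriodQuotientProofs.lean`,
`F1Sign2/TwistPeriodUnitProofs.lean`, `F1Sign2/TwistPeriodUnitCanonicalProofs.lean`, `F1Sign2/DoorValueSupplyAtTwoProofs.lean` (v37 §9–§14).
[cite: KrizLi2019, Thm. 5.1, Lemma 5.12, Ex. 6.1, Rem. 1.14] [cite: Zhai2016, Thm. 1.2] [cite: Kramer1981, Prop. 6] [cite: Ono2001, Thm. 3.5]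
REF1 §129 ADDENDUM (2026-08-28T18:41:30Z, kit j314292; `REF1-data/b129/out/eta129-summary.txt` 0a205da8d17fef21): η = 0 on 40/40 egg-class and 9/9 off-egg
Ш_an-even slice curves, controls 16/16 η = [egg]; KILL list 40 labels, CONTRARY list ∅ — the `ShaTwoTrivial W` binder of p/p′/p″/p‴ is exactly what these witness.
PARTITION: none moved; beyond-print theorem: no; BSD not proved; 23715 not closed. -/

/-- **AN-33p `EggPeriodIndexLawAtTwo` (v29; CONJECTURE-GRADE — the typed RESIDUAL of `hSup` on the egg sub-slice after AN-33m/n/o).**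
On the slice (`W` globally minimal, non-CM, surjective mod `2^n`, odd torsion, odd Tamagawa, analytic rank `1`) with `Δ(W) > 0` and newform `f`:
there are a symbol unit `u` with `η_f = 1` (`F_{q₀} ∈ (2ℤ+1)u` at some `3`-cycle prime `q₀ ∤ N` — the content of AN-33f `EggSymbolParityLawAtTwo`,
for slice curves that MEET THE EGG — hypothesis `MeetsEgg W`, CORRECTED in v34) and a rational period index `κ` (`Ω⁻_f = κ·|Ω⁻(W)|`; `κ = k/c`, Manin constant `c`, lattice index `k`, by
`exists_int_maninConstant_mul_minusPeriod_eq`) such that for every admissible door `d < 0`, `d ≡ 1 (4)` square-free, `gcd(d, N_W) = 1` and every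
globally minimal model `Wd = C • W^{(d)}`: `v₂(u·κ/|u(C)|) ≤ 0`.  By AN-33q (`doorUnitValueAt_of_pureCycle_of_periodIndex`, PROVED) this and
`hasEntireLFunction_rat` make EVERY pure-`3`-cycle door of such a `W` a unit door (`DoorUnitValueAt W d` with `t = s = 0`), so `hSup` on the egg
sub-slice reduces to it plus the existence of ONE door-admissible pure-`3`-cycle `d_K` (Chebotarev).  Census support: ENGINE U (j310561–3) 516/516
egg-class curves × all pure doors `|d| ≤ 1 200` have `v₂(L(Wd,1)/Ω(Wd)) = 0`, which by AN-33o equals `v₂(uκ/|u(C)|)` at `η = 1`; the split into `u`, `κ`,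
`|u(C)|` separately is NOT instrumented by the census.  Why it might fail: a non-optimal slice curve with even lattice index `k` relative to `c`
(excluded on the big-image slice only if every isogeny in the class is odd — true: no rational `2`-isogeny), or Pal's `ũ₂ ≠ 1` for the tree's
`quadraticTwist` model at `2` (`|u(C)|` even) — both would shift `v₂` uniformly in `d` and are decidable per curve. -/
@[conjecture] def EggPeriodIndexLawAtTwo : Prop :=
  ∀ (W : WeierstrassCurve ℚ) [W.IsElliptic] [W.IsGloballyMinimal] [NeZero (W.conductorNorm ℤ)],
    ¬ W.HasCM → (∀ n : ℕ, W.HasSurjectiveModNGaloisRep ((2 ^ n : ℕ) : ℤ)) → Odd W.torsionOrder → Odd W.tamagawaProduct →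
    W.analyticRank = 1 → 0 < W.Δ → MeetsEgg W → ShaTwoTrivial W →
    ∀ (N : ℕ) [NeZero N] (f : CuspForm (Gamma0 N) 2), IsNewformOf W f →
    ∃ (u κ : ℚ), IsMinusSymbolUnit f u ∧ minusPeriod f = (κ : ℝ) * W.imaginaryPeriodRat ∧
      (∃ (q₀ : ℕ) (a₀ z₀ : ℤ), q₀.Prime ∧ Odd q₀ ∧ ¬ q₀ ∣ N ∧ cuspCoeff f q₀ = (a₀ : ℂ) ∧ Odd a₀ ∧
        minusHalfSum f q₀ = (2 * z₀ + 1) * u) ∧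
      ∀ (d : ℤ), d < 0 → Squarefree d → d % 4 = 1 → Int.gcd d (W.conductorNorm ℤ) = 1 →
        ∀ (Wd : WeierstrassCurve ℚ) [Wd.IsGloballyMinimal] (C : VariableChange ℚ), C • W.quadraticTwist (d : ℚ) = Wd →
          padicValRat 2 (u * κ / |(C.u : ℚ)|) ≤ 0

/-- **AN-33p′ `EggHalfOddSymbolLawAtTwo` (v30; CONJECTURE-GRADE — the PERIOD-FREE, DOOR-FREE residual of `hSup` on the egg sub-slice with good
reduction at `2`).**  On the slice (`W` globally minimal, non-CM, surjective mod `2^n`, odd torsion, odd Tamagawa, analytic rank `1`) with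
`Δ(W) > 0`, good reduction at `2`, and newform `f`: there is a minus-symbol unit `u` with `v₂(u) ≤ −1` and `η_f(u) = 1`, i.e.
`F_{q₀} = (2z₀+1)·u` at some `3`-cycle prime `q₀ ∤ N` (equivalently: `F_{q₀}/u_max` is odd AND `v₂(u_max) ≤ −1`, `u_max` the maximal symbol
unit; equivalently `η_f = 1 ∧ v₂(F_{q₀}) ≤ −1`).  By AN-33t/AN-33u (§10, PROVED modulo the Greenberg–Vatsal/Abbes–Ullmo named fact
`numRealComponents_mul_imaginaryPeriodRat_eq_unit_mul_minusPeriod_two` and `hasEntireLFunction_rat`) this makes EVERY admissible pure-`3`-cycle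
door of `W` a unit door with `v₂(L(Wd,1)/Ω(Wd)) = 1 + v₂(u) ≤ 0` — no period index `κ`, no model scalar `u(C)` (Pal's `ũ = 1` is a tree
theorem), and the valuation is the SAME at all pure doors (all-or-nothing per curve, AN-33t″).  It replaces AN-33p on `{2 ∤ N_W}`; it is a finite
modular-symbol computation per curve (two half-sums and the gcd of the Manin symbols).  Census support: ENGINE U 516/516 egg-class (`MeetsEgg`) curves (there
`v₂(L(Wd,1)/Ω(Wd)) = 0` at all pure doors `|d| ≤ 1 200`, hence `v₂(u) = v₂(F_{q₀}) = −1` by AN-33t for the good-at-`2` ones).  Why it might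
fail: an egg-class slice curve with `η_f = 0` (kills AN-33f too) or with `2`-integral symbols (`v₂(u_max) ≥ 0`: then `v₂(L(Wd,1)/Ω(Wd)) ≥ 1` at
every pure door, i.e. `Ш(W^{(d)})[2] ≠ 0` uniformly in `d` under BSD). -/
@[conjecture] def EggHalfOddSymbolLawAtTwo : Prop :=
  ∀ (W : WeierstrassCurve ℚ) [W.IsElliptic] [W.IsGloballyMinimal] [NeZero (W.conductorNorm ℤ)],
    ¬ W.HasCM → (∀ n : ℕ, W.HasSurjectiveModNGaloisRep ((2 ^ n : ℕ) : ℤ)) → Odd W.torsionOrder → Odd W.tamagawaProduct →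
    W.analyticRank = 1 → 0 < W.Δ → MeetsEgg W → ShaTwoTrivial W → W.HasGoodReductionAtPrime 2 →
    ∀ (N : ℕ) [NeZero N] (f : CuspForm (Gamma0 N) 2), IsNewformOf W f →
    ∃ u : ℚ, IsMinusSymbolUnit f u ∧ padicValRat 2 u ≤ -1 ∧
      ∃ (q₀ : ℕ) (a₀ z₀ : ℤ), q₀.Prime ∧ Odd q₀ ∧ ¬ q₀ ∣ N ∧ cuspCoeff f q₀ = (a₀ : ℂ) ∧ Odd a₀ ∧
        minusHalfSum f q₀ = (2 * z₀ + 1) * u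

/-- **AN-33p″ `EggEtaOneLawAtTwo` (v31; CONJECTURE-GRADE — the BARE PARITY BIT, the residual of `hSup` on the egg sub-slice with good reduction at
`2` after AN-33t/u/v/w).**  On the slice with `Δ(W) > 0` and newform `f`: `η_f = 1`, i.e. there are a minus-symbol unit `u` and a `3`-cycle prime
`q₀ ∤ N` (`a_{q₀}` odd) with `F_{q₀} = (2z₀+1)·u`.  This is the egg-class half of the census law «η_W = egg» (ENGINE U: 611/611 `Δ > 0` slice curves, `η = 1` on exactly the 516
egg-class ones — hence the hypothesis `MeetsEgg W`, omitted in v31–v33 and CORRECTED in v34; `η` is scale-free, so the engine's bit is this bit provided its unit is the gcd of ALL symbols) restricted to the slice, with no period,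
no model, no valuation clause: AN-33w (`padicValRat_le_neg_one_of_isMinusSymbolUnit`, PROVED: `½ ∈ uℤ`) supplies `v₂(u) ≤ −1`, so
`EggEtaOneLawAtTwo → EggHalfOddSymbolLawAtTwo` (`eggHalfOddSymbolLawAtTwo_of_eggEtaOneLaw`), and AN-33x glues it to `DoorUnitValueAt` at every
admissible pure-`3`-cycle door of a good-at-`2` egg-class slice curve.  Why it might fail: an egg-class slice curve with `F_{q₀}/u_max` even
(none among 516; it would make `v₂(L(Wd,1)/Ω(Wd)) ≥ 1`, i.e. `Ш(W^{(d)})[2] ≠ 0` under BSD, at EVERY pure door `d`). -/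
@[conjecture] def EggEtaOneLawAtTwo : Prop :=
  ∀ (W : WeierstrassCurve ℚ) [W.IsElliptic] [W.IsGloballyMinimal] [NeZero (W.conductorNorm ℤ)],
    ¬ W.HasCM → (∀ n : ℕ, W.HasSurjectiveModNGaloisRep ((2 ^ n : ℕ) : ℤ)) → Odd W.torsionOrder → Odd W.tamagawaProduct →
    W.analyticRank = 1 → 0 < W.Δ → MeetsEgg W → ShaTwoTrivial W →
    ∀ (N : ℕ) [NeZero N] (f : CuspForm (Gamma0 N) 2), IsNewformOf W f →
    ∃ u : ℚ, IsMinusSymbolUnit f u ∧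
      ∃ (q₀ : ℕ) (a₀ z₀ : ℤ), q₀.Prime ∧ Odd q₀ ∧ ¬ q₀ ∣ N ∧ cuspCoeff f q₀ = (a₀ : ℂ) ∧ Odd a₀ ∧
        minusHalfSum f q₀ = (2 * z₀ + 1) * u

/-- **AN-33p‴ `EggTwiceHalfSumOddLawAtTwo` (v32; CONJECTURE-GRADE — the CANONICAL PARITY BIT, the residual of `hSup` on the egg sub-slice with
good reduction at `2`).**  On the slice with `Δ(W) > 0` and newform `f` of level `N`: there is a `3`-cycle prime `q₀ ∤ N` (`a_{q₀}` odd) with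
`2·F_{q₀}(f) = 2·Σ_{k=1}^{(q₀−1)/2} [k/q₀]⁻_f` an ODD INTEGER.  No unit, no period, no model: by AN-33y every `[k/q₀]⁻_f ∈ ½ℤ`, so
`2F_{q₀} ∈ ℤ` unconditionally, and its parity is independent of the `3`-cycle prime (AN-33c with `u = ½`).  ENGINE U's bit `η` (516/516
egg-class slice curves have `η = 1`) IS this bit: the engine unit is the gcd of symbols at denominators coprime to `N`, observed `= 1`
resp. `= ½` in its normalisation on all 2 444 `Δ>0` resp. 4 404 `Δ<0` curve rows — the span generator; the census LAW is `η_W = [MeetsEgg W]`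
(611/611: `η = 1` on the 516 egg-class curves, `η = 0` on the 95 off-egg ones, smallest `359a1`) — so the hypothesis `MeetsEgg W` below is
NECESSARY (v32–v33 omitted it: false as typed on those 95, CORRECTED in v34).  `EggEtaOneLawAtTwo → this`
(`eggTwiceHalfSumOddLawAtTwo_of_eggEtaOneLaw`, PROVED).  Why it might fail: an egg-class slice curve with `2F_{q₀}` even (none in the
census; it would force `Ш(W^{(d)})[2] ≠ 0` under BSD at EVERY admissible pure-`3`-cycle door). -/
@[conjecture] def EggTwiceHalfSumOddLawAtTwo : Prop :=
  ∀ (W : WeierstrassCurve ℚ) [W.IsElliptic] [W.IsGloballyMinimal] [NeZero (W.conductorNorm ℤ)],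
    ¬ W.HasCM → (∀ n : ℕ, W.HasSurjectiveModNGaloisRep ((2 ^ n : ℕ) : ℤ)) → Odd W.torsionOrder → Odd W.tamagawaProduct →
    W.analyticRank = 1 → 0 < W.Δ → MeetsEgg W → ShaTwoTrivial W →
    ∀ (N : ℕ) [NeZero N] (f : CuspForm (Gamma0 N) 2), IsNewformOf W f →
      ∃ (q₀ : ℕ) (a₀ z₀ : ℤ), q₀.Prime ∧ Odd q₀ ∧ ¬ q₀ ∣ N ∧ cuspCoeff f q₀ = (a₀ : ℂ) ∧ Odd a₀ ∧
        minusHalfSum f q₀ = (2 * z₀ + 1) / 2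

end Summit.BirchSwinnertonDyer.Rank1Residual.F1Sign2.ANg16

end
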